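import Summits.AtomisticToContinuum.Crystallization.Theorems.SquareWellLayerCakeGapTwelveToBarlowUniformSpacingTransfer
import Summits.AtomisticToContinuum.Crystallization.Theorems.PhononSlackCertificatesPeriodicGivenLayeredLayerCake1
import Summits.AtomisticToContinuum.Crystallization.Theorems.PhononSlackCertificatesPeriodicGivenLayeredExtraction2
import Summits.AtomisticToContinuum.Crystallization.Theorems.PhononSlackCertificatesPeriodicGivenLayeredClosing2
import Summits.AtomisticToContinuum.Crystallization.Theorems.GscTwinLoopSurgeryGscHingeGlueBarlow

/-!
# `stub_uniformSpacingSelection` (crux `GapTwelveToBarlow`, stmt-AtomisticToContinuum-15807), bridge side, IV: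
# template geometry for the finite-`N` counting (b1)

Elementary geometry of the relaxed layered template `layeredPos a s z m i j = i u + j v + L_s(m) w + z m e₃`
(`UniformSpacingTransfer`) needed by the finite-`N` double counting of the hull ⇒ a.e. bridge
(`uniformSpacingSelection-REPORT.md`, (b1)), all reduced to the `layerVec` bookkeeping of
`LayeredHull` (`PhononSlackCertificatesPeriodicGivenLayeredLayerCake1`):

* `sel_layeredPos_eq_layerVec`, `sel_layeredPos_sub_eq`: template points and their differences are
  `layerVec`s;
* `sel_norm_layeredPos_sub_le`: `‖P(m,i,j) − P(m₀,i₀,j₀)‖ ≤ |i−i₀| + |j−j₀| + 2|m−m₀|` (`a ≤ 1`, label walk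
  `1`-Lipschitz `sel_abs_haggLabel_sub_le`, heights `17a/20`-Lipschitz `sel_abs_height_sub_le`);
* `sel_index_bounds`: conversely `‖P(m,i,j) − P(m₀,i₀,j₀)‖ ≤ r` forces `|m−m₀| ≤ 2r`, `|j−j₀| ≤ 2r`,
  `|i−i₀| ≤ 4r` (coordinate bounds `cake_abs_*_le_norm`, `a ≥ 47/50`);
* `sel_layeredPos_inj`, `sel_layeredPos_sep`: the parametrisation is injective and the template is
  `1/2`-separated (`cake_param_injective`, `cake_separated`);
* `sel_card_perLayer_le`: at most `(8r+1)(4r+1)` template points of one layer within `r` of a base point;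
* `sel_cube_card`, `sel_cube_norm_le`: the `(2J+1)³` points of the index cube of half-width `J` around a
  base index are distinct template points within `4J` of the base point.
-/

noncomputable section

namespace Summit.AtomisticToContinuum.Crystallization.Theorems.SquareWellLayerCakeGapTwelveToBarlow

open scoped BigOperators
open Filter Topology Literature.MathematicalPhysics.StatisticalMechanics
open Summit.AtomisticToContinuum.Crystallization.Theorems.LayeredHull


/-! ## Template points as `layerVec`s -/

/-- A relaxed template point is the `layerVec` of height `z m` and label `L_s(m)`. [folklore] -/
theorem sel_layeredPos_eq_layerVec (a : ℝ) (s : ℤ → ℤ) (z : ℤ → ℝ) (m i j : ℤ) :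
    layeredPos a s z m i j = layerVec a (z m) (haggLabel s m) 1 i j := by
  unfold layeredPos
  exact cake_pt_eq_layerVec a (z m) (haggLabel s m) i j

/-- Differences of template points are `layerVec`s of the index differences. [folklore] -/
theorem sel_layeredPos_sub_eq (a : ℝ) (s : ℤ → ℤ) (z : ℤ → ℝ) (m i j m₀ i₀ j₀ : ℤ) :
    layeredPos a s z m i j - layeredPos a s z m₀ i₀ j₀ =
      layerVec a (z m - z m₀) (haggLabel s m - haggLabel s m₀) 1 (i - i₀) (j - j₀) := by
  rw [sel_layeredPos_eq_layerVec, sel_layeredPos_eq_layerVec, cake_layerVec_sub]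

/-! ## Norms of the lattice vectors, Lipschitz bounds -/

/-- `‖u(a)‖ = |a|`. [folklore] -/
theorem sel_norm_triangularVec₁ (a : ℝ) : ‖(triangularVec₁ a : (EuclideanSpace ℝ (Fin 3)))‖ = |a| := by
  rw [EuclideanSpace.norm_eq, Fin.sum_univ_three]
  simp [triangularVec₁, Real.sqrt_sq_eq_abs]

/-- `‖v(a)‖ = |a|`. [folklore] -/
theorem sel_norm_triangularVec₂ (a : ℝ) : ‖(triangularVec₂ a : (EuclideanSpace ℝ (Fin 3)))‖ = |a| := by
  have h : ‖(triangularVec₂ a : (EuclideanSpace ℝ (Fin 3)))‖ ^ 2 = a ^ 2 := by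
    rw [EuclideanSpace.norm_eq, Real.sq_sqrt (by positivity), Fin.sum_univ_three]
    simp [triangularVec₂, Real.norm_eq_abs, sq_abs, div_pow, mul_pow,
      Real.sq_sqrt (show (0 : ℝ) ≤ 3 by norm_num)]
    ring
  rw [← Real.sqrt_sq (norm_nonneg (triangularVec₂ a : (EuclideanSpace ℝ (Fin 3)))), h, Real.sqrt_sq_eq_abs]

/-- The label walk is `1`-Lipschitz (real form): `|L_s(m) − L_s(m₀)| ≤ |m − m₀|`. [folklore] -/
theorem sel_abs_haggLabel_sub_le {s : ℤ → ℤ} (hs : IsHaggSeq s) (m m₀ : ℤ) :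
    |((haggLabel s m : ℤ) : ℝ) - haggLabel s m₀| ≤ |(m : ℝ) - m₀| := by
  have key : ∀ p : ℤ, ∀ k : ℕ, |((haggLabel s (p + k) : ℤ) : ℝ) - haggLabel s p| ≤ k := by
    intro p k
    rw [haggLabel_add_natCast]
    push_cast
    rw [add_sub_cancel_left]
    exact_mod_cast GscHingeGlue.abs_haggWindow_le hs p k
  rcases le_total m₀ m with h | h
  · obtain ⟨k, rfl⟩ : ∃ k : ℕ, m = m₀ + k := ⟨(m - m₀).toNat, by omega⟩
    have := key m₀ k
    push_cast
    rwa [add_sub_cancel_left, Nat.abs_cast]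
  · obtain ⟨k, rfl⟩ : ∃ k : ℕ, m₀ = m + k := ⟨(m₀ - m).toNat, by omega⟩
    have := key m k
    push_cast
    rw [show |(m : ℝ) - (m + k)| = k by
      rw [abs_sub_comm, add_sub_cancel_left, Nat.abs_cast]]
    rwa [abs_sub_comm] at this

/-- Heights in the box are `17a/20`-Lipschitz in the layer index. [folklore] -/
theorem sel_abs_height_sub_le {a : ℝ} {z : ℤ → ℝ} (ha0 : 0 ≤ a)
    (hz : ∀ m : ℤ, 39 / 50 * a ≤ z (m + 1) - z m ∧ z (m + 1) - z m ≤ 17 / 20 * a) (m m₀ : ℤ) :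
    |z m - z m₀| ≤ 17 / 20 * a * |(m : ℝ) - m₀| := by
  rcases le_total m₀ m with h | h
  · obtain ⟨k, rfl⟩ : ∃ k : ℕ, m = m₀ + k := ⟨(m - m₀).toNat, by omega⟩
    have h1 := clo_height_add hz m₀ k
    have hk0 : (0 : ℝ) ≤ 39 / 50 * a * k := by positivity
    push_cast
    rw [add_sub_cancel_left, Nat.abs_cast, abs_of_nonneg (hk0.trans h1.1)]
    exact h1.2
  · obtain ⟨k, rfl⟩ : ∃ k : ℕ, m₀ = m + k := ⟨(m₀ - m).toNat, by omega⟩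
    have h1 := clo_height_sub hz (m + k) k
    rw [add_sub_cancel_right] at h1
    have hk0 : (0 : ℝ) ≤ 39 / 50 * a * k := by positivity
    push_cast
    rw [abs_sub_comm (z m), show (m : ℝ) - (m + k) = -k by ring, abs_neg, Nat.abs_cast,
      abs_of_nonneg (hk0.trans h1.1)]
    exact h1.2

/-- Crude norm bound of a `layerVec` (`0 ≤ a ≤ 1`): `‖p u + q v + δ w + H e₃‖ ≤ |p| + |q| + |δ| + |H|`.
[folklore] -/
theorem sel_norm_layerVec_le {a : ℝ} (ha0 : 0 ≤ a) (ha1 : a ≤ 1) (H : ℝ) (δ p q : ℤ) :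
    ‖layerVec a H δ 1 p q‖ ≤ |(p : ℝ)| + |(q : ℝ)| + |(δ : ℝ)| + |H| := by
  rw [← cake_pt_eq_layerVec]
  have hu : ‖(p : ℝ) • (triangularVec₁ a : (EuclideanSpace ℝ (Fin 3)))‖ ≤ |(p : ℝ)| := by
    rw [norm_smul, Real.norm_eq_abs, sel_norm_triangularVec₁, abs_of_nonneg ha0]
    exact mul_le_of_le_one_right (abs_nonneg _) ha1
  have hv : ‖(q : ℝ) • (triangularVec₂ a : (EuclideanSpace ℝ (Fin 3)))‖ ≤ |(q : ℝ)| := by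
    rw [norm_smul, Real.norm_eq_abs, sel_norm_triangularVec₂, abs_of_nonneg ha0]
    exact mul_le_of_le_one_right (abs_nonneg _) ha1
  have hw : ‖(δ : ℝ) • (barlowOffset a : (EuclideanSpace ℝ (Fin 3)))‖ ≤ |(δ : ℝ)| := by
    rw [norm_smul, Real.norm_eq_abs]
    exact mul_le_of_le_one_right (abs_nonneg _) (ext_norm_barlowOffset_le ha0 ha1)
  have he : ‖H • (layerNormal 1 : (EuclideanSpace ℝ (Fin 3)))‖ = |H| := by
    rw [norm_smul, Real.norm_eq_abs, ext_norm_layerNormal_one, mul_one]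
  calc ‖((p : ℝ) • triangularVec₁ a) + ((q : ℝ) • triangularVec₂ a) + ((δ : ℝ) • barlowOffset a) +
        (H • layerNormal 1)‖
      ≤ ‖((p : ℝ) • triangularVec₁ a) + ((q : ℝ) • triangularVec₂ a) + ((δ : ℝ) • barlowOffset a)‖ +
        ‖H • (layerNormal 1 : (EuclideanSpace ℝ (Fin 3)))‖ := norm_add_le _ _
    _ ≤ (‖((p : ℝ) • triangularVec₁ a) + ((q : ℝ) • triangularVec₂ a)‖ + ‖(δ : ℝ) • (barlowOffset a : (EuclideanSpace ℝ (Fin 3)))‖) +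
        ‖H • (layerNormal 1 : (EuclideanSpace ℝ (Fin 3)))‖ := by gcongr; exact norm_add_le _ _
    _ ≤ ((‖(p : ℝ) • (triangularVec₁ a : (EuclideanSpace ℝ (Fin 3)))‖ + ‖(q : ℝ) • (triangularVec₂ a : (EuclideanSpace ℝ (Fin 3)))‖) +
        ‖(δ : ℝ) • (barlowOffset a : (EuclideanSpace ℝ (Fin 3)))‖) + ‖H • (layerNormal 1 : (EuclideanSpace ℝ (Fin 3)))‖ := by gcongr; exact norm_add_le _ _
    _ ≤ |(p : ℝ)| + |(q : ℝ)| + |(δ : ℝ)| + |H| := by rw [he]; linarith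

/-- **Norm bound of template differences**: `‖P(m,i,j) − P(m₀,i₀,j₀)‖ ≤ |i−i₀| + |j−j₀| + 2|m−m₀|`
(`47/50 ≤ a ≤ 1`, heights in the box). [folklore] -/
theorem sel_norm_layeredPos_sub_le {a : ℝ} (ha : 47 / 50 ≤ a) (ha1 : a ≤ 1) {s : ℤ → ℤ} (hs : IsHaggSeq s)
    {z : ℤ → ℝ} (hz : ∀ m : ℤ, 39 / 50 * a ≤ z (m + 1) - z m ∧ z (m + 1) - z m ≤ 17 / 20 * a)
    (m i j m₀ i₀ j₀ : ℤ) :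
    ‖layeredPos a s z m i j - layeredPos a s z m₀ i₀ j₀‖ ≤
      |(i : ℝ) - i₀| + |(j : ℝ) - j₀| + 2 * |(m : ℝ) - m₀| := by
  rw [sel_layeredPos_sub_eq]
  refine (sel_norm_layerVec_le (by linarith) ha1 _ _ _ _).trans ?_
  have hL := sel_abs_haggLabel_sub_le hs m m₀
  have hH := sel_abs_height_sub_le (by linarith) hz m m₀
  have h0 : 0 ≤ |(m : ℝ) - m₀| := abs_nonneg _
  push_cast at hL ⊢
  nlinarith

/-! ## Index bounds from a norm bound -/

/-- `173/100 ≤ √3`. [folklore] -/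
theorem sel_sqrt_three_ge : (173 / 100 : ℝ) ≤ √3 :=
  Real.le_sqrt_of_sq_le (by norm_num)

/-- **Index bounds.** If `‖P(m,i,j) − P(m₀,i₀,j₀)‖ ≤ r` then `|m−m₀| ≤ 2r`, `|j−j₀| ≤ 2r`, `|i−i₀| ≤ 4r`
(`47/50 ≤ a ≤ 1`, heights in the box). [folklore] -/
theorem sel_index_bounds {a : ℝ} (ha : 47 / 50 ≤ a) {s : ℤ → ℤ} (hs : IsHaggSeq s)
    {z : ℤ → ℝ} (hz : ∀ m : ℤ, 39 / 50 * a ≤ z (m + 1) - z m ∧ z (m + 1) - z m ≤ 17 / 20 * a)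
    {m i j m₀ i₀ j₀ : ℤ} {r : ℝ} (h : ‖layeredPos a s z m i j - layeredPos a s z m₀ i₀ j₀‖ ≤ r) :
    |(m : ℝ) - m₀| ≤ 2 * r ∧ |(j : ℝ) - j₀| ≤ 2 * r ∧ |(i : ℝ) - i₀| ≤ 4 * r := by
  rw [sel_layeredPos_sub_eq] at h
  have r0 : 0 ≤ r := (norm_nonneg _).trans h
  have hHn := (cake_abs_height_le_norm a (z m - z m₀) (haggLabel s m - haggLabel s m₀) (i - i₀) (j - j₀)).trans h
  have h0 := (cake_abs_fst_le_norm a (z m - z m₀) (haggLabel s m - haggLabel s m₀) (i - i₀) (j - j₀)).trans h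
  have h1 := (cake_abs_snd_le_norm a (z m - z m₀) (haggLabel s m - haggLabel s m₀) (i - i₀) (j - j₀)).trans h
  have hmH := cake_abs_height_diff_ge a (by linarith) z (fun m => (hz m).1) m₀ m
  have hL := sel_abs_haggLabel_sub_le hs m m₀
  push_cast at h0 h1 hL
  -- the layer index
  have hm : |(m : ℝ) - m₀| ≤ 2 * r := by nlinarith [abs_nonneg ((m : ℝ) - m₀)]
  -- the second in-plane index
  have hs3 := sel_sqrt_three_ge
  have hc : (81 / 100 : ℝ) ≤ a * √3 / 2 := by nlinarith
  have h1' : a * √3 / 2 * |((j : ℝ) - j₀) + ((haggLabel s m : ℝ) - haggLabel s m₀) / 3| ≤ r := by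
    rwa [abs_mul, abs_of_pos (by positivity : (0 : ℝ) < a * √3 / 2)] at h1
  have hX : |((j : ℝ) - j₀) + ((haggLabel s m : ℝ) - haggLabel s m₀) / 3| ≤ 5 / 4 * r := by
    have hXn := abs_nonneg (((j : ℝ) - j₀) + ((haggLabel s m : ℝ) - haggLabel s m₀) / 3)
    nlinarith
  have hj : |(j : ℝ) - j₀| ≤ 2 * r := by
    have e : (j : ℝ) - j₀ = (((j : ℝ) - j₀) + ((haggLabel s m : ℝ) - haggLabel s m₀) / 3) -
        ((haggLabel s m : ℝ) - haggLabel s m₀) / 3 := by ring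
    rw [e]
    refine (abs_sub _ _).trans ?_
    rw [abs_div, abs_of_pos (by norm_num : (0 : ℝ) < 3)]
    linarith
  -- the first in-plane index
  have h0' : a * |((i : ℝ) - i₀) + ((j : ℝ) - j₀) / 2 + ((haggLabel s m : ℝ) - haggLabel s m₀) / 2| ≤ r := by
    rwa [abs_mul, abs_of_pos (by linarith : (0 : ℝ) < a)] at h0
  have hY : |((i : ℝ) - i₀) + ((j : ℝ) - j₀) / 2 + ((haggLabel s m : ℝ) - haggLabel s m₀) / 2| ≤ 11 / 10 * r := by
    have hYn := abs_nonneg (((i : ℝ) - i₀) + ((j : ℝ) - j₀) / 2 + ((haggLabel s m : ℝ) - haggLabel s m₀) / 2)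
    nlinarith
  have hi : |(i : ℝ) - i₀| ≤ 4 * r := by
    have e : (i : ℝ) - i₀ = (((i : ℝ) - i₀) + ((j : ℝ) - j₀) / 2 + ((haggLabel s m : ℝ) - haggLabel s m₀) / 2) -
        (((j : ℝ) - j₀) / 2 + ((haggLabel s m : ℝ) - haggLabel s m₀) / 2) := by ring
    rw [e]
    refine (abs_sub _ _).trans ?_
    have h2 : |((j : ℝ) - j₀) / 2 + ((haggLabel s m : ℝ) - haggLabel s m₀) / 2| ≤
        |(j : ℝ) - j₀| / 2 + |(m : ℝ) - m₀| / 2 := by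
      refine (abs_add_le _ _).trans ?_
      rw [abs_div, abs_div, abs_of_pos (by norm_num : (0 : ℝ) < 2)]
      linarith
    linarith
  exact ⟨hm, hj, hi⟩

/-! ## Injectivity and separation -/

/-- **Injectivity of the parametrisation** (heights in the box, `a > 0`). [folklore] -/
theorem sel_layeredPos_inj {a : ℝ} (ha : 0 < a) (s : ℤ → ℤ) {z : ℤ → ℝ}
    (hz : ∀ m : ℤ, 39 / 50 * a ≤ z (m + 1) - z m) {m i j m' i' j' : ℤ}
    (h : layeredPos a s z m i j = layeredPos a s z m' i' j') : m = m' ∧ i = i' ∧ j = j' := by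
  rw [sel_layeredPos_eq_layerVec, sel_layeredPos_eq_layerVec] at h
  exact cake_param_injective a ha.ne' (haggLabel s) z (cake_height_injective a ha z hz) h

/-- **`1/2`-separation of the template**: distinct indices give points at distance `≥ 1/2`
(`a ≥ 47/50`, heights in the box). [folklore] -/
theorem sel_layeredPos_sep {a : ℝ} (ha : 47 / 50 ≤ a) (s : ℤ → ℤ) {z : ℤ → ℝ}
    (hz : ∀ m : ℤ, 39 / 50 * a ≤ z (m + 1) - z m) {m i j m' i' j' : ℤ}
    (hne : (m, i, j) ≠ (m', i', j')) :
    1 / 2 ≤ dist (layeredPos a s z m i j) (layeredPos a s z m' i' j') := by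
  have hpq : layeredPos a s z m i j ≠ layeredPos a s z m' i' j' := by
    intro h
    obtain ⟨rfl, rfl, rfl⟩ := sel_layeredPos_inj (by linarith) s hz h
    exact hne rfl
  refine cake_separated a ha LinearIsometry.id s z hz _ ⟨m, i, j, rfl⟩ _ ⟨m', i', j', rfl⟩ ?_
  simpa [layeredPos] using hpq

/-! ## Counting template points -/

/-- **Per-layer count.** The template points of ONE layer `m` within `r` of a base point have indices in
a box: a finset of such index pairs has at most `(8r+1)(4r+1)` elements. [folklore] -/
theorem sel_card_perLayer_le {a : ℝ} (ha : 47 / 50 ≤ a) {s : ℤ → ℤ} (hs : IsHaggSeq s)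
    {z : ℤ → ℝ} (hz : ∀ m : ℤ, 39 / 50 * a ≤ z (m + 1) - z m ∧ z (m + 1) - z m ≤ 17 / 20 * a)
    (m m₀ i₀ j₀ : ℤ) (r : ℕ) (F : Finset (ℤ × ℤ))
    (hF : ∀ ij ∈ F, ‖layeredPos a s z m ij.1 ij.2 - layeredPos a s z m₀ i₀ j₀‖ ≤ r) :
    F.card ≤ (8 * r + 1) * (4 * r + 1) := by
  have hsub : F ⊆ Finset.Icc (i₀ - 4 * r) (i₀ + 4 * r) ×ˢ Finset.Icc (j₀ - 2 * r) (j₀ + 2 * r) := by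
    intro ij hij
    obtain ⟨-, hj, hi⟩ := sel_index_bounds ha hs hz (hF ij hij)
    rw [abs_le] at hi hj
    have hi1 : ((i₀ - 4 * r : ℤ) : ℝ) ≤ ij.1 := by push_cast; linarith [hi.1]
    have hi2 : ((ij.1 : ℤ) : ℝ) ≤ ((i₀ + 4 * r : ℤ) : ℝ) := by push_cast; linarith [hi.2]
    have hj1 : ((j₀ - 2 * r : ℤ) : ℝ) ≤ ij.2 := by push_cast; linarith [hj.1]
    have hj2 : ((ij.2 : ℤ) : ℝ) ≤ ((j₀ + 2 * r : ℤ) : ℝ) := by push_cast; linarith [hj.2]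
    rw [Finset.mem_product, Finset.mem_Icc, Finset.mem_Icc]
    exact ⟨⟨by exact_mod_cast hi1, by exact_mod_cast hi2⟩, ⟨by exact_mod_cast hj1, by exact_mod_cast hj2⟩⟩
  refine (Finset.card_le_card hsub).trans ?_
  rw [Finset.card_product, Int.card_Icc, Int.card_Icc]
  have e1 : (i₀ + 4 * r + 1 - (i₀ - 4 * r)).toNat = 8 * r + 1 := by omega
  have e2 : (j₀ + 2 * r + 1 - (j₀ - 2 * r)).toNat = 4 * r + 1 := by omega
  rw [e1, e2]

/-- **The index cube.** The `(2J+1)³` indices of the cube of half-width `J` around `(m₀, i₀, j₀)` give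
`(2J+1)³` distinct template points. [folklore] -/
theorem sel_cube_card {a : ℝ} (ha : 0 < a) (s : ℤ → ℤ) {z : ℤ → ℝ}
    (hz : ∀ m : ℤ, 39 / 50 * a ≤ z (m + 1) - z m) (m₀ i₀ j₀ : ℤ) (J : ℕ) :
    ((Finset.Icc (m₀ - J) (m₀ + J) ×ˢ (Finset.Icc (i₀ - J) (i₀ + J) ×ˢ Finset.Icc (j₀ - J) (j₀ + J))).image
      fun t : ℤ × (ℤ × ℤ) => layeredPos a s z t.1 t.2.1 t.2.2).card = (2 * J + 1) ^ 3 := by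
  rw [Finset.card_image_of_injOn, Finset.card_product, Finset.card_product, Int.card_Icc, Int.card_Icc,
    Int.card_Icc]
  · have e1 : (m₀ + J + 1 - (m₀ - J)).toNat = 2 * J + 1 := by omega
    have e2 : (i₀ + J + 1 - (i₀ - J)).toNat = 2 * J + 1 := by omega
    have e3 : (j₀ + J + 1 - (j₀ - J)).toNat = 2 * J + 1 := by omega
    rw [e1, e2, e3]; ring
  · rintro ⟨m, i, j⟩ - ⟨m', i', j'⟩ - h
    obtain ⟨rfl, rfl, rfl⟩ := sel_layeredPos_inj ha s hz h
    rfl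

/-- **The index cube lies within `4J` of the base point.** [folklore] -/
theorem sel_cube_norm_le {a : ℝ} (ha : 47 / 50 ≤ a) (ha1 : a ≤ 1) {s : ℤ → ℤ} (hs : IsHaggSeq s)
    {z : ℤ → ℝ} (hz : ∀ m : ℤ, 39 / 50 * a ≤ z (m + 1) - z m ∧ z (m + 1) - z m ≤ 17 / 20 * a)
    (m₀ i₀ j₀ : ℤ) (J : ℕ) :
    ∀ p ∈ ((Finset.Icc (m₀ - J) (m₀ + J) ×ˢ (Finset.Icc (i₀ - J) (i₀ + J) ×ˢ Finset.Icc (j₀ - J) (j₀ + J))).image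
        fun t : ℤ × (ℤ × ℤ) => layeredPos a s z t.1 t.2.1 t.2.2),
      ‖p - layeredPos a s z m₀ i₀ j₀‖ ≤ 4 * J := by
  intro p hp
  obtain ⟨⟨m, i, j⟩, ht, rfl⟩ := Finset.mem_image.1 hp
  simp only [Finset.mem_product, Finset.mem_Icc] at ht
  obtain ⟨⟨hm1, hm2⟩, ⟨hi1, hi2⟩, ⟨hj1, hj2⟩⟩ := ht
  refine (sel_norm_layeredPos_sub_le ha ha1 hs hz m i j m₀ i₀ j₀).trans ?_
  have hm : |(m : ℝ) - m₀| ≤ J := by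
    rw [abs_le]; constructor
    · have : ((m₀ - J : ℤ) : ℝ) ≤ m := by exact_mod_cast hm1
      push_cast at this; linarith
    · have : (m : ℝ) ≤ ((m₀ + J : ℤ) : ℝ) := by exact_mod_cast hm2
      push_cast at this; linarith
  have hi : |(i : ℝ) - i₀| ≤ J := by
    rw [abs_le]; constructor
    · have : ((i₀ - J : ℤ) : ℝ) ≤ i := by exact_mod_cast hi1
      push_cast at this; linarith
    · have : (i : ℝ) ≤ ((i₀ + J : ℤ) : ℝ) := by exact_mod_cast hi2
      push_cast at this; linarith
  have hj : |(j : ℝ) - j₀| ≤ J := by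
    rw [abs_le]; constructor
    · have : ((j₀ - J : ℤ) : ℝ) ≤ j := by exact_mod_cast hj1
      push_cast at this; linarith
    · have : (j : ℝ) ≤ ((j₀ + J : ℤ) : ℝ) := by exact_mod_cast hj2
      push_cast at this; linarith
  linarith

/-- **Anchor (registered sub-goal form of `sel_index_bounds`, closed statement):** index bounds of the
relaxed template from a norm bound. [folklore] -/
theorem stub_templateIndexBounds :
    ∀ (a : ℝ), 47 / 50 ≤ a → ∀ (s : ℤ → ℤ), IsHaggSeq s → ∀ (z : ℤ → ℝ),
      (∀ m : ℤ, 39 / 50 * a ≤ z (m + 1) - z m ∧ z (m + 1) - z m ≤ 17 / 20 * a) →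
      ∀ (m i j m₀ i₀ j₀ : ℤ) (r : ℝ), ‖layeredPos a s z m i j - layeredPos a s z m₀ i₀ j₀‖ ≤ r →
        |(m : ℝ) - m₀| ≤ 2 * r ∧ |(j : ℝ) - j₀| ≤ 2 * r ∧ |(i : ℝ) - i₀| ≤ 4 * r :=
  fun _ ha _ hs _ hz _ _ _ _ _ _ _ h => sel_index_bounds ha hs hz h

end Summit.AtomisticToContinuum.Crystallization.Theorems.SquareWellLayerCakeGapTwelveToBarlow

end
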